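/-
Copyright (c) 2026. All rights reserved.
Released under Apache 2.0 license as described in the file LICENSE.
Authors: abc-iut cell, seat abc-iut-L4-t9 (gen 3; block W2-B2, model of [AbsTopIII] Cor 3.7).
-/
import Literature.AnabelianGeometry.AbsoluteAnabelian.AbsTopIII.MLFGaloisModelCategories
import Literature.AnabelianGeometry.AbsoluteAnabelian.AbsTopIII.PadicEmbeddingRigidity
import Literature.AnabelianGeometry.AbsoluteAnabelian.GaloisPadicLogInstance
import Mathlib.FieldTheory.Galois.Infinite
import HarnessLib

/-!
# [AbsTopIII] Def 3.1 (ii)–(iv): RIGIDITY of morphisms of model MLF-Galois `TF`-pairs on `ℚ̄_p`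

S. Mochizuki, *Topics in absolute anabelian geometry III* [MochizukiAbsTopIII2015] (kurims manuscript
`paper:url-5493eb38cbb7`), Def 3.1 (iii)/(iv) pp. 68–69: the natural functors `𝒞^MLF_TF → 𝒞^MLF_TM`, ...,
`λ^×`, `λ^{×pf}`, `log_{TF,TF}` exist because the formation of `𝒪^⊳_k̄`, `k̄^×`, `𝒪^×_k̄`, `k~` from `k̄`
"is clearly intrinsically defined [i.e., depends only on the 'input data of an object of `T`']", and
Rmk 3.1.1 p. 70: "the topology on the field `k̄`, the groups `k̄^×` and `𝒪^×_k̄`, or the monoid `𝒪^⊳_k̄` is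
completely determined by the field, group, or monoid structures of these objects [...] the fact that
`𝒪^×_k̄ ⊆ k̄^×` may be characterized as the subgroup of elements divisible by arbitrary powers of some
prime number".

Proof-only companion of `MLFGaloisModelCategories.lean` (abc-iut-L4-t9) making "intrinsically defined"
a kernel fact for the MODEL category `𝒳 = TFModel p` (model MLF-Galois `TF`-pairs `(Π_k ↷ ℚ̄_p)`,
Galois-isomorphisms): for every morphism `φ = (φ_Π, φ_M)`,

* `TFModel.Hom.homM_algebraMap` — `φ_M : ℚ̄_p → ℚ̄_p` is `ℚ_p`-LINEAR: `φ_M` maps the base `k₁` into the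
  fixed field of `ε₂(φ_Π(Π₁)) = G_{k₂}`, i.e. into `k₂` (infinite Galois correspondence, Mathlib
  `InfiniteGalois.mem_range_algebraMap_iff_fixed`), and a ring homomorphism `ℚ_p → k₂` into a finite
  extension of `ℚ_p` is the structure map (the cell's `AbsTopIII.padicRingHom_eq_algebraMap`,
  [AbsTopIII] Rmk 1.5.4 (iii) tools);
* `TFModel.Hom.galois` — hence `φ_M` IS an element `σ_φ ∈ Gal(ℚ̄_p/ℚ_p)` (an algebraic endomorphism of an
  algebraic extension is bijective), and consequently `φ_M` preserves the absolute value
  (`norm_homM`), the units `𝒪^×_{ℚ̄_p}` (`homM_mem_unitSubmonoid_iff`), and commutes with the Iwasawa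
  logarithm (`log_homM`); the Galois augmentations are intertwined by conjugation (`augQ_homPi`);
* `PadicAlgCl.algEquiv_eq_refl_of_forall_div_pow_eq_one` — FAITHFULNESS of `Gal(ℚ̄_p/ℚ_p)` on the
  perfection `(ℚ̄_p^×)^pf = ℚ̄_p^×/μ`: an automorphism `σ` with `σ(x)/x` a root of unity for every `x ≠ 0`
  is the identity (so `(Π ↷ (k̄^×)^pf)` has the same arithmetic Galois group `G_k` as `(Π ↷ k̄)`, as an
  MLF-Galois `TS`-pair must, Def 3.1 (i)/(ii) for `T = TS`: "faithful continuous `G_k`-action").  Proof: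
  if `σ x ≠ x`, the roots of unity `σ(x + pʲ)/(x + pʲ)` and `σ(x)/x` differ but their quotient tends
  to `1`, contradicting the injectivity of `log_p` near `1` (abc-iut-L3-t11's
  `PadicAlgCl.eq_one_of_log_eq_zero_of_norm_le`).

HONEST FRAMING: classical `p`-adic facts used as the functoriality/naturality engine of the MODEL of
Cor 3.7; nothing here bears on [IUTchIII] Cor. 3.12.
-/

set_option autoImplicit false

noncomputable section

namespace Literature.AnabelianGeometry.AbsoluteAnabelian.AbsTopIII

open Literature.NumberTheory.Transcendental

variable {p : ℕ} [hp : Fact p.Prime]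

/-! ## Galois-theoretic preliminaries on `ℚ_p ⊆ k ⊆ ℚ̄_p` -/

/-- `ℚ̄_p/ℚ_p` is Galois (normal as an algebraic closure, separable in characteristic `0`) — used for
`G_k := Gal(k̄/k)` of Def 3.1 (i). [cite: MochizukiAbsTopIII2015, Definition 3.1 (i) p.66] -/
theorem PadicAlgCl.isGalois : IsGalois ℚ_[p] (PadicAlgCl p) :=
  isGalois_iff.2 ⟨inferInstance, inferInstance⟩

/-- Automorphisms of `ℚ̄_p/ℚ_p` are isometries (the norm of `ℚ̄_p` is the spectral norm; "the topology on
the field `k̄` [...] is completely determined by the field [...] structure", Rmk 3.1.1).  Private copy of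
a three-line fact also proved in `Literature.NumberTheory.LFunctions.Dwork` (not imported: unrelated
import chain). [cite: MochizukiAbsTopIII2015, Remark 3.1.1 p.70] -/
private theorem PadicAlgCl.norm_algEquiv (σ : PadicAlgCl p ≃ₐ[ℚ_[p]] PadicAlgCl p) (z : PadicAlgCl p) :
    ‖σ z‖ = ‖z‖ := by
  rw [← PadicAlgCl.spectralNorm_eq, ← PadicAlgCl.spectralNorm_eq]
  exact (spectralNorm_eq_of_equiv σ z).symm

/-- `‖p‖ = p⁻¹` in `ℚ̄_p` (the element `p ∈ 𝒪^⊳_k̄ ∖ 𝒪^×_k̄` of Lemma 3.4's proof).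
[cite: MochizukiAbsTopIII2015, Lemma 3.4 p.74] -/
theorem PadicAlgCl.norm_natCast_prime : ‖(p : PadicAlgCl p)‖ = (p : ℝ)⁻¹ := by
  rw [← map_natCast (algebraMap ℚ_[p] (PadicAlgCl p)) p, norm_algebraMap', Padic.norm_p]

namespace TFModel

/-- The Galois augmentation `ε_k(g)` of a model object viewed in `Gal(ℚ̄_p/ℚ_p) ⊇ G_k`.
[cite: MochizukiAbsTopIII2015, Definition 3.1 (i) p.66] -/
def augQ (A : TFModel p) (g : A.pair.Pi) : PadicAlgCl p ≃ₐ[ℚ_[p]] PadicAlgCl p :=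
  (A.D.aug g).restrictScalars ℚ_[p]

/-- `augQ` is `ε_k(g)` as a function. [cite: MochizukiAbsTopIII2015, Definition 3.1 (i) p.66] -/
@[simp] theorem augQ_apply (A : TFModel p) (g : A.pair.Pi) (x : PadicAlgCl p) :
    A.augQ g x = (A.D.aug g : PadicAlgCl p ≃ₐ[A.k] PadicAlgCl p) x := rfl

/-- `augQ` is a group homomorphism `Π_k → Gal(ℚ̄_p/ℚ_p)`. [cite: MochizukiAbsTopIII2015, Definition 3.1 (i) p.66] -/
theorem augQ_mul (A : TFModel p) (g h : A.pair.Pi) : A.augQ (g * h) = A.augQ g * A.augQ h := by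
  have hmul : A.D.aug (g * h) = A.D.aug g * A.D.aug h := map_mul A.D.aug g h
  ext x
  rw [AlgEquiv.mul_apply, augQ_apply, augQ_apply, augQ_apply, hmul, AlgEquiv.mul_apply]

/-- `augQ 1 = 1`. [cite: MochizukiAbsTopIII2015, Definition 3.1 (i) p.66] -/
@[simp] theorem augQ_one (A : TFModel p) : A.augQ 1 = 1 := by
  have h1 : A.D.aug (1 : A.pair.Pi) = 1 := map_one A.D.aug
  ext x
  rw [augQ_apply, h1, AlgEquiv.one_apply, AlgEquiv.one_apply]

/-- The action of `Π_k` on `k̄ = ℚ̄_p` is through `augQ`. [cite: MochizukiAbsTopIII2015, Definition 3.1 (i) p.67] -/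
theorem smul_eq_augQ (A : TFModel p) (g : A.pair.Pi) (x : A.pair.M) :
    g • x = A.augQ g (show PadicAlgCl p from x) := rfl

/-- `ε_k(g)` fixes the base field `k`. [cite: MochizukiAbsTopIII2015, Definition 3.1 (i) p.66] -/
theorem augQ_apply_of_mem (A : TFModel p) (g : A.pair.Pi) {y : PadicAlgCl p} (hy : y ∈ A.k) :
    A.augQ g y = y :=
  (A.D.aug g).commutes (⟨y, hy⟩ : A.k)

/-- An element of `ℚ̄_p` fixed by `G_k = Gal(ℚ̄_p/k)` lies in `k` (infinite Galois correspondence; the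
"subfield of Galois-invariants `(k~)^{Π_k}`" computations of Def 3.1 (iv)). [cite: MochizukiAbsTopIII2015, Definition 3.1 (iv) p.69] -/
theorem mem_k_of_fixed (A : TFModel p) {y : PadicAlgCl p}
    (h : ∀ τ : PadicAlgCl p ≃ₐ[A.k] PadicAlgCl p, τ y = y) : y ∈ A.k := by
  haveI := PadicAlgCl.isGalois (p := p)
  obtain ⟨z, hz⟩ := (InfiniteGalois.mem_range_algebraMap_iff_fixed (k := A.k) y).2 h
  rw [← hz]
  exact z.2

/-! ## Rigidity: `φ_M` is `ℚ_p`-linear, hence an element of `Gal(ℚ̄_p/ℚ_p)` -/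

namespace Hom

variable {A B : TFModel p}

/-- `φ_M` maps `k₁`-rational elements to `G_{k₂}`-invariants: compatibility with the actions plus
surjectivity of `ε₂ ∘ φ_Π : Π₁ → G_{k₂}`. [cite: MochizukiAbsTopIII2015, Definition 3.1 (ii) p.67] -/
theorem homM_fixed (f : Hom A B) {y : PadicAlgCl p} (hy : y ∈ A.k)
    (τ : PadicAlgCl p ≃ₐ[B.k] PadicAlgCl p) : τ (f.hom.homM y) = f.hom.homM y := by
  obtain ⟨h, rfl⟩ := B.D.aug_surjective τ
  obtain ⟨g, rfl⟩ := f.bijective.2 h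
  have hc := f.hom.smul_comm g y
  rw [B.smul_eq_augQ, A.smul_eq_augQ, A.augQ_apply_of_mem g hy] at hc
  exact hc.symm

/-- Hence `φ_M(k₁) ⊆ k₂`. [cite: MochizukiAbsTopIII2015, Definition 3.1 (ii) p.67] -/
theorem homM_mem_k (f : Hom A B) {y : PadicAlgCl p} (hy : y ∈ A.k) : f.hom.homM y ∈ B.k :=
  B.mem_k_of_fixed (f.homM_fixed hy)

/-- **`φ_M` is `ℚ_p`-linear**: its restriction `ℚ_p → k₂` is a ring homomorphism into a finite extension
of `ℚ_p`, hence the structure map ([AbsTopIII] Rmk 1.5.4 (iii) rigidity, `padicRingHom_eq_algebraMap`).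
[cite: MochizukiAbsTopIII2015, Remark 3.1.1 p.70] -/
theorem homM_algebraMap (f : Hom A B) (x : ℚ_[p]) :
    f.hom.homM (algebraMap ℚ_[p] (PadicAlgCl p) x) = algebraMap ℚ_[p] (PadicAlgCl p) x := by
  have hmem : ∀ x : ℚ_[p], (f.hom.homM.comp (algebraMap ℚ_[p] (PadicAlgCl p))) x ∈ B.k := fun x =>
    f.homM_mem_k (A.k.algebraMap_mem x)
  let ψ : ℚ_[p] →+* B.k := (f.hom.homM.comp (algebraMap ℚ_[p] (PadicAlgCl p))).codRestrict B.k hmem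
  have hψ : ψ = algebraMap ℚ_[p] B.k := padicRingHom_eq_algebraMap ψ
  have h1 : ((ψ x : B.k) : PadicAlgCl p) = f.hom.homM (algebraMap ℚ_[p] (PadicAlgCl p) x) := rfl
  rw [← h1, hψ]
  exact (IsScalarTower.algebraMap_apply ℚ_[p] B.k (PadicAlgCl p) x).symm

/-- `φ_M` as a `ℚ_p`-algebra endomorphism of `ℚ̄_p`. [cite: MochizukiAbsTopIII2015, Remark 3.1.1 p.70] -/
def galoisHom (f : Hom A B) : PadicAlgCl p →ₐ[ℚ_[p]] PadicAlgCl p :=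
  { (f.hom.homM : PadicAlgCl p →+* PadicAlgCl p) with commutes' := f.homM_algebraMap }

/-- `galoisHom` is `φ_M` as a function. [cite: MochizukiAbsTopIII2015, Remark 3.1.1 p.70] -/
@[simp] theorem galoisHom_apply (f : Hom A B) (x : PadicAlgCl p) : f.galoisHom x = f.hom.homM x := rfl

/-- **`φ_M ∈ Gal(ℚ̄_p/ℚ_p)`**: a `ℚ_p`-algebra endomorphism of the algebraic extension `ℚ̄_p/ℚ_p` is an
automorphism.  In particular every Galois-isomorphism of model `TF`-pairs on `ℚ̄_p` is a
`T`-isomorphism as well. [cite: MochizukiAbsTopIII2015, Remark 3.1.1 p.70] -/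
def galois (f : Hom A B) : PadicAlgCl p ≃ₐ[ℚ_[p]] PadicAlgCl p :=
  AlgEquiv.ofBijective f.galoisHom (Algebra.IsAlgebraic.algHom_bijective f.galoisHom)

/-- `galois` is `φ_M` as a function. [cite: MochizukiAbsTopIII2015, Remark 3.1.1 p.70] -/
@[simp] theorem galois_apply (f : Hom A B) (x : PadicAlgCl p) : f.galois x = f.hom.homM x := rfl

/-- `φ_M` is bijective. [cite: MochizukiAbsTopIII2015, Remark 3.1.1 p.70] -/
theorem homM_bijective (f : Hom A B) : Function.Bijective f.hom.homM := f.galois.bijective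

/-- `φ_M = σ_φ` preserves the absolute value of `ℚ̄_p`. [cite: MochizukiAbsTopIII2015, Remark 3.1.1 p.70] -/
theorem norm_galois (f : Hom A B) (x : PadicAlgCl p) : ‖f.galois x‖ = ‖x‖ :=
  PadicAlgCl.norm_algEquiv f.galois x

/-- `φ_M = σ_φ` preserves the units `𝒪^×_{ℚ̄_p} = {‖x‖ = 1}` (abc-iut-L4-t2's `unitSubmonoid`, identified
by abc-iut-L3-t11's `PadicAlgCl.mem_unitSubmonoid_iff`). [cite: MochizukiAbsTopIII2015, Remark 3.1.1 p.70] -/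
theorem galois_mem_unitSubmonoid_iff (f : Hom A B) (x : PadicAlgCl p) :
    f.galois x ∈ unitSubmonoid ℚ_[p] (PadicAlgCl p) ↔ x ∈ unitSubmonoid ℚ_[p] (PadicAlgCl p) := by
  rw [PadicAlgCl.mem_unitSubmonoid_iff, PadicAlgCl.mem_unitSubmonoid_iff, norm_galois]

/-- `φ_M = σ_φ` maps non-zero elements to non-zero elements. [cite: MochizukiAbsTopIII2015, Definition 3.1 (ii) p.67] -/
theorem galois_ne_zero (f : Hom A B) {x : PadicAlgCl p} (hx : x ≠ 0) : f.galois x ≠ 0 :=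
  (map_ne_zero_iff f.galois f.galois.injective).2 hx

/-- `φ_M = σ_φ` commutes with the Iwasawa logarithm of `ℚ̄_p` ("the power series used to define `log_k̄`
[is] intrinsically defined", Def 3.1 (iv) p. 68; the tree's `padicLogAlgCl` is
`Gal(ℚ̄_p/ℚ_p)`-equivariant). [cite: MochizukiAbsTopIII2015, Definition 3.1 (iv) p.68] -/
theorem log_galois (f : Hom A B) {x : PadicAlgCl p} (hx : x ≠ 0) :
    padicLogAlgCl p (f.galois x) = f.galois (padicLogAlgCl p x) :=
  (padicLogAlgCl_isIwasawaLog_holds p).algEquiv f.galois hx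

/-- The Galois augmentations are intertwined by `φ_M`: `ε₂(φ_Π g) = σ_φ ∘ ε₁(g) ∘ σ_φ⁻¹` in
`Gal(ℚ̄_p/ℚ_p)` (compatibility of `φ_M` with the actions). [cite: MochizukiAbsTopIII2015, Definition 3.1 (ii) p.67] -/
theorem augQ_homPi (f : Hom A B) (g : A.pair.Pi) :
    B.augQ (f.hom.homPi g) = (f.galois.symm.trans (A.augQ g)).trans f.galois := by
  ext x
  obtain ⟨y, rfl⟩ := f.galois.surjective x
  have hc := f.hom.smul_comm g y
  rw [B.smul_eq_augQ, A.smul_eq_augQ] at hc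
  rw [AlgEquiv.trans_apply, AlgEquiv.trans_apply, AlgEquiv.symm_apply_apply, galois_apply, ← hc]
  rfl

/-- Pointwise form: `ε₂(φ_Π g)(φ_M y) = φ_M(ε₁(g) y)`. [cite: MochizukiAbsTopIII2015, Definition 3.1 (ii) p.67] -/
theorem augQ_homPi_apply (f : Hom A B) (g : A.pair.Pi) (y : PadicAlgCl p) :
    B.augQ (f.hom.homPi g) (f.hom.homM y) = f.hom.homM (A.augQ g y) := by
  have hc := f.hom.smul_comm g y
  rw [B.smul_eq_augQ, A.smul_eq_augQ] at hc
  exact hc.symm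

end Hom

end TFModel

/-! ## Faithfulness of `Gal(ℚ̄_p/ℚ_p)` on `ℚ̄_p^× / μ` -/

/-- A root of unity of `ℚ̄_p` has absolute value `1` (`μ ⊆ 𝒪^×_k̄`, Def 3.1 (i)).
[cite: MochizukiAbsTopIII2015, Definition 3.1 (i) p.66] -/
theorem PadicAlgCl.norm_eq_one_of_pow_eq_one {z : PadicAlgCl p} {n : ℕ} (hn : 0 < n) (hz : z ^ n = 1) :
    ‖z‖ = 1 := by
  have h : ‖z‖ ^ n = 1 := by rw [← norm_pow, hz, norm_one]
  exact (pow_eq_one_iff_of_nonneg (norm_nonneg z) hn.ne').mp h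

/-- A root of unity of `ℚ̄_p` has Iwasawa logarithm `0` ("pf": `log_k̄` factors through `(𝒪^×_k̄)^pf`,
Def 3.1 (i)). [cite: MochizukiAbsTopIII2015, Definition 3.1 (i) p.66] -/
theorem PadicAlgCl.log_eq_zero_of_pow_eq_one {z : PadicAlgCl p} {n : ℕ} (hn : 0 < n) (hz : z ^ n = 1) :
    padicLogAlgCl p z = 0 := by
  have hI := padicLogAlgCl_isIwasawaLog_holds p
  have hz0 : z ≠ 0 := by
    rintro rfl
    rw [zero_pow hn.ne'] at hz
    exact zero_ne_one hz
  have h := hI.log_pow hz0 n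
  rw [hz, hI.log_one] at h
  have hn0 : (n : PadicAlgCl p) ≠ 0 := by exact_mod_cast hn.ne'
  exact (mul_eq_zero.mp h.symm).resolve_left hn0

/-- Two roots of unity of `ℚ̄_p` at distance `≤ p⁻²` coincide (injectivity of `log_p` on the ball
`‖1 − z‖ ≤ p⁻²`, abc-iut-L3-t11; injectivity of `log_k̄` on `(𝒪^×_k̄)^pf`, Def 3.1 (i)).
[cite: MochizukiAbsTopIII2015, Definition 3.1 (i) p.66] -/
theorem PadicAlgCl.eq_of_pow_eq_one_of_norm_sub_le {z w : PadicAlgCl p} {n m : ℕ} (hn : 0 < n)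
    (hz : z ^ n = 1) (hm : 0 < m) (hw : w ^ m = 1) (hd : ‖z - w‖ ≤ ((p : ℝ) ^ 2)⁻¹) : z = w := by
  have hI := padicLogAlgCl_isIwasawaLog_holds p
  have hw1 : ‖w‖ = 1 := PadicAlgCl.norm_eq_one_of_pow_eq_one hm hw
  have hw0 : w ≠ 0 := norm_pos_iff.mp (by rw [hw1]; exact one_pos)
  have hz0 : z ≠ 0 := by
    rintro rfl
    rw [zero_pow hn.ne'] at hz
    exact zero_ne_one hz
  -- the quotient `z / w` is a root of unity close to `1`
  have hq : (z / w) ^ (n * m) = 1 := by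
    rw [div_pow, pow_mul, hz, one_pow, pow_mul', hw, one_pow, div_one]
  have hlog : padicLogAlgCl p (z / w) = 0 := PadicAlgCl.log_eq_zero_of_pow_eq_one (Nat.mul_pos hn hm) hq
  have hnorm : ‖1 - z / w‖ ≤ ((p : ℝ) ^ 2)⁻¹ := by
    have h1 : 1 - z / w = (w - z) / w := by field_simp
    rw [h1, norm_div, hw1, div_one, norm_sub_rev]
    exact hd
  have h := PadicAlgCl.eq_one_of_log_eq_zero_of_norm_le p hnorm hlog
  rwa [div_eq_one_iff_eq hw0] at h

/-- **`Gal(ℚ̄_p/ℚ_p)` acts faithfully on `ℚ̄_p^×/μ`**: if `σ(x)/x` is a root of unity for every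
`x ≠ 0`, then `σ = 1`.  Proof: were `σ x ≠ x`, the roots of unity `ζ_j := σ(x + pʲ)/(x + pʲ)` and
`ζ := σ(x)/x` would satisfy `ζ_j ≠ ζ` (else `pʲ = 0`) while `‖ζ_j − ζ‖ = ‖σ x − x‖·p^{−j}/‖x‖² → 0`,
contradicting the uniform discreteness of roots of unity.  (This is why `(Π ↷ (k̄^×)^pf)` is an
MLF-Galois `TS`-pair with arithmetic Galois group `G_k`: Def 3.1 (i) requires a FAITHFUL `G_k`-action.)
[cite: MochizukiAbsTopIII2015, Definition 3.1 (iv) p.69] -/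
theorem PadicAlgCl.algEquiv_eq_refl_of_forall_div_pow_eq_one (σ : PadicAlgCl p ≃ₐ[ℚ_[p]] PadicAlgCl p)
    (h : ∀ x : PadicAlgCl p, x ≠ 0 → ∃ n : ℕ, 0 < n ∧ (σ x / x) ^ n = 1) :
    σ = AlgEquiv.refl := by
  have hp1 : (1 : ℝ) < p := by exact_mod_cast hp.out.one_lt
  ext x
  rw [AlgEquiv.coe_refl, id]
  by_contra hne
  have hx0 : x ≠ 0 := by
    rintro rfl
    exact hne (map_zero σ)
  have hd0 : σ x - x ≠ 0 := sub_ne_zero.mpr hne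
  have hxn : 0 < ‖x‖ := norm_pos_iff.mpr hx0
  have hdn : 0 < ‖σ x - x‖ := norm_pos_iff.mpr hd0
  -- choose `j` with `p^{-j} < ‖x‖` and `‖σ x - x‖ p^{-j} ≤ p⁻² ‖x‖²`
  have hε : (0 : ℝ) < min ‖x‖ (((p : ℝ) ^ 2)⁻¹ * ‖x‖ ^ 2 / ‖σ x - x‖) := lt_min hxn (by positivity)
  obtain ⟨j, hj⟩ := exists_pow_lt_of_lt_one hε (inv_lt_one_of_one_lt₀ hp1)
  have hjx : ((p : ℝ)⁻¹) ^ j < ‖x‖ := lt_of_lt_of_le hj (min_le_left _ _)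
  have hjd : ((p : ℝ)⁻¹) ^ j < ((p : ℝ) ^ 2)⁻¹ * ‖x‖ ^ 2 / ‖σ x - x‖ :=
    lt_of_lt_of_le hj (min_le_right _ _)
  -- the perturbation `c = p^j ∈ ℚ_p` and `y = x + c`
  have hcn : ‖(p : PadicAlgCl p) ^ j‖ = ((p : ℝ)⁻¹) ^ j := by rw [norm_pow, PadicAlgCl.norm_natCast_prime]
  have hσc : σ ((p : PadicAlgCl p) ^ j) = (p : PadicAlgCl p) ^ j := by rw [map_pow, map_natCast]
  have hyn : ‖x + (p : PadicAlgCl p) ^ j‖ = ‖x‖ := by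
    rw [IsUltrametricDist.norm_add_eq_max_of_norm_ne_norm (by rw [hcn]; exact hjx.ne'),
      max_eq_left (by rw [hcn]; exact hjx.le)]
  have hy0 : x + (p : PadicAlgCl p) ^ j ≠ 0 := norm_pos_iff.mp (by rw [hyn]; exact hxn)
  have hσy : σ (x + (p : PadicAlgCl p) ^ j) = (x + (p : PadicAlgCl p) ^ j) + (σ x - x) := by
    rw [map_add, hσc]; ring
  -- the two roots of unity
  obtain ⟨n, hn, hζ⟩ := h x hx0
  obtain ⟨m, hm, hζ'⟩ := h _ hy0
  have hdist : ‖σ (x + (p : PadicAlgCl p) ^ j) / (x + (p : PadicAlgCl p) ^ j) - σ x / x‖ ≤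
      ((p : ℝ) ^ 2)⁻¹ := by
    have h1 : σ (x + (p : PadicAlgCl p) ^ j) / (x + (p : PadicAlgCl p) ^ j) - σ x / x =
        -((σ x - x) * (p : PadicAlgCl p) ^ j) / (x * (x + (p : PadicAlgCl p) ^ j)) := by
      rw [hσy]
      field_simp
      ring
    rw [h1, norm_div, norm_neg, norm_mul, norm_mul, hyn, hcn]
    rw [lt_div_iff₀ hdn] at hjd
    rw [div_le_iff₀ (mul_pos hxn hxn)]
    nlinarith [hjd, hxn, hdn]
  have heq := PadicAlgCl.eq_of_pow_eq_one_of_norm_sub_le hm hζ' hn hζ hdist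
  -- `σ y / y = σ x / x` forces `p^j = 0`
  rw [div_eq_div_iff hy0 hx0, hσy] at heq
  have h3 : (σ x - x) * (p : PadicAlgCl p) ^ j = 0 := by
    have h4 : (x + (p : PadicAlgCl p) ^ j + (σ x - x)) * x - σ x * (x + (p : PadicAlgCl p) ^ j) =
        -((σ x - x) * (p : PadicAlgCl p) ^ j) := by ring
    rw [← neg_eq_zero, ← h4, sub_eq_zero]
    exact heq
  rcases mul_eq_zero.mp h3 with h5 | h5
  · exact hd0 h5
  · exact pow_ne_zero j (IwasawaLog.natCast_prime_ne_zero p) h5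

/-- Faithfulness on `ℚ̄_p^× / μ` for units: if `σ x / x` is a root of unity for every unit `x : ℚ̄_pˣ`,
then `σ = 1` (restatement over `Units`). [cite: MochizukiAbsTopIII2015, Definition 3.1 (iv) p.69] -/
theorem PadicAlgCl.algEquiv_eq_refl_of_forall_units (σ : PadicAlgCl p ≃ₐ[ℚ_[p]] PadicAlgCl p)
    (h : ∀ u : (PadicAlgCl p)ˣ, ∃ n : ℕ, 0 < n ∧ (σ (u : PadicAlgCl p) / u) ^ n = 1) :
    σ = AlgEquiv.refl :=
  PadicAlgCl.algEquiv_eq_refl_of_forall_div_pow_eq_one σ fun x hx => h (Units.mk0 x hx)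

end Literature.AnabelianGeometry.AbsoluteAnabelian.AbsTopIII

end
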